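import Literature.Analysis.FluidPDE.HardSphereCollisionRecord
import HarnessLib

/-!
# The time-ordered enumeration of the collision times of a hard-sphere trajectory

Companion to `Literature.Analysis.FluidPDE.HardSphereCollisionRecord`, which DEFINES, for a curve
`γ : ℝ → Config N d X`, the collision times `collisionTimes G ε γ`, the collision times
`collisionTimesOf G ε γ k` of one particle `k`, and the enumerators
`nextTimeAfter S x = sInf (S ∩ (x, ∞))`, `nthTimeAfter S a n = (nextTimeAfter S)^[n+1] a`,
`nthCollisionTime G ε γ a n`, `nthCollisionTimeOf G ε γ a k n` (the `n`-th collision (of `k`)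
strictly after time `a`), and along a flow `HardSphereFlow.nthCollisionTimeOf Φ i n z`. That file
identifies only the FIRST enumerated time (`isLeast_nextTimeAfter`,
`IsHardSphereTrajectory.isLeast_nthCollisionTimeOf_zero`). Nothing is (re)defined here; this file
proves that the enumeration is what its name says — the finite set of collision times (of a
particle) in a window `(a, s]`, LISTED IN INCREASING ORDER, exhaustively
(Gallagher–Saint-Raymond–Texier 2013 Def. 4.1.2 / Prop. 4.1.1: on the good set collision times are
locally finite, so "the sequence of collision times `t_1 < t_2 < ⋯` of the trajectory" and "the
`n`-th collision of particle `i`" make sense; Aoki–Pulvirenti–Simonella–Tsuji 2015 §5 records a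
trajectory by this ordered list `{t_m}`):

* for a set of reals `S` finite on bounded intervals (`∀ a b, (S ∩ Ioc a b).Finite`):
  `nextTimeAfter_le`, `nextTimeAfter_mem`, `lt_nextTimeAfter`,
  `not_mem_of_mem_Ioo_nextTimeAfter` (no element of `S` is skipped),
  `isLeast_nthTimeAfter_succ` (the `(n+1)`-st time is the least element after the `n`-th),
  `nthTimeAfter_chain`, `exists_nthTimeAfter_eq` (EVERY element of `S` after `a` is enumerated),
  and the packaged statement `nthTimeAfter_enum`: for `s ∈ S`, `a < s` there is an index `m` with
  `nthTimeAfter S a m = s`, `n ↦ nthTimeAfter S a n` strictly increasing on `{0, …, m}` with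
  values in `S ∩ (a, s]`, onto `S ∩ (a, s]` — i.e. `n ↦ nthTimeAfter S a n`, `n ≤ m`, is the
  increasing bijection `{0, …, m} ≃o S ∩ (a, s]`;
* on a hard-sphere trajectory (`IsHardSphereTrajectory G ε N γ`, collision times locally finite):
  the specialisations to all collisions (`exists_nthCollisionTime_eq`, `nthCollisionTime_enum`,
  `isLeast_nthCollisionTime_succ`, `not_mem_collisionTimes_of_mem_Ioo_nthCollisionTime_succ`) and
  to the collisions of one particle (`exists_nthCollisionTimeOf_eq`, `nthCollisionTimeOf_enum`,
  `isLeast_nthCollisionTimeOf_succ`, `not_participates_of_mem_Ioo_nthCollisionTimeOf_succ`),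
  with the finiteness of `collisionTimesOf G ε γ k ∩ S` for every bounded set of times `S`
  (`finite_collisionTimesOf_inter_of_subset_Icc`, `finite_collisionTimesOf_inter_Ioc`; the record
  file has the `Ioo` window only, `CollisionalTransfer` the all-particle `Ioc` window);
* along a hard-sphere flow on its good set (`HardSphereFlow.exists_nthCollisionTimeOf_eq`,
  `HardSphereFlow.nthCollisionTimeOf_enum`): every collision of particle `i` at a positive time
  along the orbit of `z` is `Φ.nthCollisionTimeOf i n z` for some `n`, in increasing order.

## Mathlib / Literature reuse

`IsLeast`, `Set.infinite_of_injective_forall_mem`, `strictMono_nat_of_lt_succ`, `Nat.find` are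
Mathlib's; `isLeast_nextTimeAfter`, `nthTimeAfter_succ`, `collisionTimesOf_subset`,
`IsHardSphereTrajectory.finite_collisionTimes_inter_of_subset_Icc`, `HardSphereFlow.isTrajectory`
are the record file's / `HardSphereDynamics`'. Mathlib's `Nat.nth` / `Nat.Subtype.orderIsoOfNat`
enumerate subsets of `ℕ`, and `Finset.orderEmbOfFin` enumerates a FIXED finite set; the collision
times form a locally finite subset of `ℝ` enumerated from a variable origin `a`, for which the
`sInf`-iteration of the record file is the definition in use, so the order-isomorphism property
is proved for it directly.

## Design choices

* Hypothesis `∀ a b, (S ∩ Ioc a b).Finite` (finite on bounded half-open intervals), which is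
  what `isLeast_nextTimeAfter` consumes pointwise and what `IsHardSphereTrajectory.locFinite`
  gives at once.
* The exhaustion statement is proved by contradiction through
  `Set.infinite_of_injective_forall_mem` (an enumeration missing `s` would be a strictly
  increasing sequence inside the finite set `S ∩ (a, s]`), avoiding cardinality bookkeeping.
* Junk values are inherited: past the last element of `S` the enumerators return `sInf ∅ = 0`;
  all statements here are guarded by the existence of a later element.

## References

* I. Gallagher, L. Saint-Raymond, B. Texier, *From Newton to Boltzmann: hard spheres and
  short-range potentials*, EMS (2013), §4.1, Def. 4.1.2, Prop. 4.1.1.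
* K. Aoki, M. Pulvirenti, S. Simonella, T. Tsuji, *Backward clusters, hierarchy and wild sums for
  a hard sphere system in a low-density regime*, M3AS 25 (2015), §5.
-/

open Set Function

namespace Literature.Analysis.FluidPDE

noncomputable section

/-! ## Enumeration of a locally finite set of reals from an origin -/

section Enumeration

variable {S : Set ℝ}

/-- The next element of `S` after `x` is at most every element of `S` after `x`
(`S` finite on the bounded intervals `(x, b]`). [folklore] -/
theorem nextTimeAfter_le {x : ℝ} (hfin : ∀ b, (S ∩ Ioc x b).Finite) {s : ℝ} (hs : s ∈ S)
    (hxs : x < s) : nextTimeAfter S x ≤ s :=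
  (isLeast_nextTimeAfter hfin ⟨s, hs, hxs⟩).2 ⟨hs, hxs⟩

/-- If `S` has an element after `x`, the next element after `x` belongs to `S`. [folklore] -/
theorem nextTimeAfter_mem {x : ℝ} (hfin : ∀ b, (S ∩ Ioc x b).Finite) (hne : (S ∩ Ioi x).Nonempty) :
    nextTimeAfter S x ∈ S :=
  (isLeast_nextTimeAfter hfin hne).1.1

/-- If `S` has an element after `x`, the next element after `x` is strictly after `x`. [folklore] -/
theorem lt_nextTimeAfter {x : ℝ} (hfin : ∀ b, (S ∩ Ioc x b).Finite) (hne : (S ∩ Ioi x).Nonempty) :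
    x < nextTimeAfter S x :=
  (isLeast_nextTimeAfter hfin hne).1.2

/-- **No element is skipped**: there is no element of `S` strictly between `x` and the next
element of `S` after `x`. [folklore] -/
theorem not_mem_of_mem_Ioo_nextTimeAfter {x : ℝ} (hfin : ∀ b, (S ∩ Ioc x b).Finite) {u : ℝ}
    (hu : u ∈ Ioo x (nextTimeAfter S x)) : u ∉ S := fun huS =>
  (not_le.2 hu.2) (nextTimeAfter_le hfin huS hu.1)

/-- The first enumerated element after `a` is the least element of `S` after `a`. [folklore] -/
theorem isLeast_nthTimeAfter_zero {a : ℝ} (hfin : ∀ b, (S ∩ Ioc a b).Finite)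
    (hne : (S ∩ Ioi a).Nonempty) : IsLeast (S ∩ Ioi a) (nthTimeAfter S a 0) :=
  isLeast_nextTimeAfter hfin hne

/-- **The recursion is the order recursion**: if `S` has an element after the `n`-th enumerated
time, the `(n+1)`-st enumerated time is the least such element. [folklore] -/
theorem isLeast_nthTimeAfter_succ (hfin : ∀ a b, (S ∩ Ioc a b).Finite) {a : ℝ} {n : ℕ}
    (hne : (S ∩ Ioi (nthTimeAfter S a n)).Nonempty) :
    IsLeast (S ∩ Ioi (nthTimeAfter S a n)) (nthTimeAfter S a (n + 1)) := by
  rw [nthTimeAfter_succ]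
  exact isLeast_nextTimeAfter (hfin _) hne

/-- Consecutive enumerated times increase strictly (as long as `S` has a later element). [folklore] -/
theorem nthTimeAfter_lt_succ (hfin : ∀ a b, (S ∩ Ioc a b).Finite) {a : ℝ} {n : ℕ}
    (hne : (S ∩ Ioi (nthTimeAfter S a n)).Nonempty) :
    nthTimeAfter S a n < nthTimeAfter S a (n + 1) :=
  (isLeast_nthTimeAfter_succ hfin hne).1.2

/-- No element of `S` lies strictly between two consecutive enumerated times. [folklore] -/
theorem not_mem_of_mem_Ioo_nthTimeAfter_succ (hfin : ∀ a b, (S ∩ Ioc a b).Finite) {a : ℝ} {n : ℕ}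
    {u : ℝ} (hu : u ∈ Ioo (nthTimeAfter S a n) (nthTimeAfter S a (n + 1))) : u ∉ S := by
  rw [nthTimeAfter_succ] at hu
  exact not_mem_of_mem_Ioo_nextTimeAfter (hfin _) hu

/-- No element of `S` lies strictly between the origin `a` and the first enumerated time. [folklore] -/
theorem not_mem_of_mem_Ioo_nthTimeAfter_zero {a : ℝ} (hfin : ∀ b, (S ∩ Ioc a b).Finite) {u : ℝ}
    (hu : u ∈ Ioo a (nthTimeAfter S a 0)) : u ∉ S :=
  not_mem_of_mem_Ioo_nextTimeAfter hfin hu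

/-- **The enumeration before it reaches `s`.** Let `s ∈ S`, `a < s`. As long as the enumerated
times `nthTimeAfter S a k`, `k < n`, have not reached `s`, the `n`-th one is an element of `S` in
`(a, s]`, strictly larger than all the previous ones. [folklore] -/
theorem nthTimeAfter_chain (hfin : ∀ a b, (S ∩ Ioc a b).Finite) {a s : ℝ} (hs : s ∈ S)
    (has : a < s) {n : ℕ} (hn : ∀ k < n, nthTimeAfter S a k ≠ s) :
    nthTimeAfter S a n ∈ S ∧ a < nthTimeAfter S a n ∧ nthTimeAfter S a n ≤ s ∧
      ∀ k < n, nthTimeAfter S a k < nthTimeAfter S a n := by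
  induction n with
  | zero =>
    have hl := isLeast_nthTimeAfter_zero (hfin a) ⟨s, hs, has⟩
    exact ⟨hl.1.1, hl.1.2, hl.2 ⟨hs, has⟩, fun k hk => absurd hk (Nat.not_lt_zero k)⟩
  | succ n ih =>
    obtain ⟨-, hagt, hle, hlt⟩ := ih fun k hk => hn k (hk.trans n.lt_succ_self)
    have hns : nthTimeAfter S a n < s := lt_of_le_of_ne hle (hn n n.lt_succ_self)
    have hl := isLeast_nthTimeAfter_succ hfin (a := a) (n := n) ⟨s, hs, hns⟩
    refine ⟨hl.1.1, hagt.trans hl.1.2, hl.2 ⟨hs, hns⟩, fun k hk => ?_⟩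
    rcases (Nat.lt_succ_iff.1 hk).lt_or_eq with hk' | rfl
    · exact (hlt k hk').trans hl.1.2
    · exact hl.1.2

/-- **Every element is enumerated**: each element of `S` after `a` is the `n`-th enumerated time
after `a` for some `n` (`S` finite on bounded intervals). [folklore] -/
theorem exists_nthTimeAfter_eq (hfin : ∀ a b, (S ∩ Ioc a b).Finite) {a s : ℝ} (hs : s ∈ S)
    (has : a < s) : ∃ n, nthTimeAfter S a n = s := by
  by_contra h
  push Not at h
  have hch : ∀ n, nthTimeAfter S a n ∈ S ∩ Ioc a s ∧
      ∀ k < n, nthTimeAfter S a k < nthTimeAfter S a n := fun n => by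
    obtain ⟨h1, h2, h3, h4⟩ := nthTimeAfter_chain hfin hs has (n := n) fun k _ => h k
    exact ⟨⟨h1, h2, h3⟩, h4⟩
  have hmono : StrictMono (nthTimeAfter S a) :=
    strictMono_nat_of_lt_succ fun n => (hch (n + 1)).2 n n.lt_succ_self
  exact Set.infinite_of_injective_forall_mem hmono.injective (fun n => (hch n).1) (hfin a s)

/-- **The enumeration is the increasing bijection onto the window.** For `s ∈ S` with `a < s`
(`S` finite on bounded intervals) there is an index `m` such that: the `m`-th enumerated time is
`s`; the enumerated times of index `≤ m` lie in `S ∩ (a, s]` and increase strictly with the index;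
and every element of `S ∩ (a, s]` is one of them. In other words `n ↦ nthTimeAfter S a n`,
`n ≤ m`, lists the finite set `S ∩ (a, s]` in increasing order. [folklore] -/
theorem nthTimeAfter_enum (hfin : ∀ a b, (S ∩ Ioc a b).Finite) {a s : ℝ} (hs : s ∈ S)
    (has : a < s) :
    ∃ m, nthTimeAfter S a m = s ∧ (∀ n ≤ m, nthTimeAfter S a n ∈ S ∩ Ioc a s) ∧
      StrictMonoOn (nthTimeAfter S a) (Iic m) ∧
      ∀ u ∈ S ∩ Ioc a s, ∃ n ≤ m, nthTimeAfter S a n = u := by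
  classical
  have hex := exists_nthTimeAfter_eq hfin hs has
  refine ⟨Nat.find hex, Nat.find_spec hex, fun n hn => ?_, fun n hn n' hn' hlt => ?_,
    fun u hu => ?_⟩
  · obtain ⟨h1, h2, h3, -⟩ := nthTimeAfter_chain hfin hs has (n := n)
      fun k hk => Nat.find_min hex (hk.trans_le hn)
    exact ⟨h1, h2, h3⟩
  · exact (nthTimeAfter_chain hfin hs has (n := n')
      fun k hk => Nat.find_min hex (hk.trans_le hn')).2.2.2 n hlt
  · have hexu := exists_nthTimeAfter_eq hfin hu.1 hu.2.1
    refine ⟨Nat.find hexu, ?_, Nat.find_spec hexu⟩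
    by_contra hlt
    push Not at hlt
    have hch := (nthTimeAfter_chain hfin hu.1 hu.2.1 (n := Nat.find hexu)
      fun k hk => Nat.find_min hexu hk).2.2.2 _ hlt
    rw [Nat.find_spec hex, Nat.find_spec hexu] at hch
    exact (not_le.2 hch) hu.2.2

end Enumeration

/-! ## On a hard-sphere trajectory -/

section Kinetic

variable {d : Type*} [Fintype d] {X : Type*} {N : ℕ}

namespace IsHardSphereTrajectory

variable [TopologicalSpace X] {G : Geometry d X} {ε : ℝ} {γ : ℝ → Config N d X}

/-- On a hard-sphere trajectory the collision times are finite on the windows `(a, b]` (the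
hypothesis shape of the enumeration lemmas; cf. `finite_collisionTimes_inter_Ioc` in
`CollisionalTransfer`). [folklore] -/
private theorem finite_inter_Ioc (h : IsHardSphereTrajectory G ε N γ) (a b : ℝ) :
    (collisionTimes G ε γ ∩ Ioc a b).Finite :=
  h.finite_collisionTimes_inter_of_subset_Icc Ioc_subset_Icc_self

/-- On a hard-sphere trajectory the collision times of one particle in every bounded set of times
are finitely many ("the finite set of collision times of particle `k` in `[a, b]`"). [folklore] -/
theorem finite_collisionTimesOf_inter_of_subset_Icc (h : IsHardSphereTrajectory G ε N γ) (k : Fin N)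
    {S : Set ℝ} {a b : ℝ} (hS : S ⊆ Icc a b) : (collisionTimesOf G ε γ k ∩ S).Finite :=
  (h.finite_collisionTimes_inter_of_subset_Icc hS).subset
    (inter_subset_inter_left _ (collisionTimesOf_subset γ k))

/-- On a hard-sphere trajectory the collision times of one particle in every window `(a, b]` are
finitely many. [folklore] -/
theorem finite_collisionTimesOf_inter_Ioc (h : IsHardSphereTrajectory G ε N γ) (k : Fin N)
    (a b : ℝ) : (collisionTimesOf G ε γ k ∩ Ioc a b).Finite :=
  h.finite_collisionTimesOf_inter_of_subset_Icc k Ioc_subset_Icc_self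

/-- **Every collision is enumerated**: on a hard-sphere trajectory each collision time after `a`
is the `n`-th collision time after `a` for some `n`. [folklore] -/
theorem exists_nthCollisionTime_eq (h : IsHardSphereTrajectory G ε N γ) {a s : ℝ}
    (hs : s ∈ collisionTimes G ε γ) (has : a < s) : ∃ n, nthCollisionTime G ε γ a n = s :=
  exists_nthTimeAfter_eq h.finite_inter_Ioc hs has

/-- On a hard-sphere trajectory with a collision after the `n`-th collision time after `a`, the
`(n+1)`-st collision time after `a` is the least later collision time. [folklore] -/
theorem isLeast_nthCollisionTime_succ (h : IsHardSphereTrajectory G ε N γ) {a : ℝ} {n : ℕ}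
    (hne : (collisionTimes G ε γ ∩ Ioi (nthCollisionTime G ε γ a n)).Nonempty) :
    IsLeast (collisionTimes G ε γ ∩ Ioi (nthCollisionTime G ε γ a n))
      (nthCollisionTime G ε γ a (n + 1)) :=
  isLeast_nthTimeAfter_succ h.finite_inter_Ioc hne

/-- On a hard-sphere trajectory there is no collision strictly between two consecutive enumerated
collision times. [folklore] -/
theorem not_mem_collisionTimes_of_mem_Ioo_nthCollisionTime_succ (h : IsHardSphereTrajectory G ε N γ)
    {a : ℝ} {n : ℕ} {u : ℝ}
    (hu : u ∈ Ioo (nthCollisionTime G ε γ a n) (nthCollisionTime G ε γ a (n + 1))) :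
    u ∉ collisionTimes G ε γ :=
  not_mem_of_mem_Ioo_nthTimeAfter_succ h.finite_inter_Ioc hu

/-- **The collision times of the window `(a, s]` in increasing order**: on a hard-sphere
trajectory, for a collision time `s > a` there is `m` with `nthCollisionTime G ε γ a m = s`,
`n ↦ nthCollisionTime G ε γ a n` strictly increasing on `{0, …, m}` with values in, and onto, the
collision times in `(a, s]`. [folklore] -/
theorem nthCollisionTime_enum (h : IsHardSphereTrajectory G ε N γ) {a s : ℝ}
    (hs : s ∈ collisionTimes G ε γ) (has : a < s) :
    ∃ m, nthCollisionTime G ε γ a m = s ∧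
      (∀ n ≤ m, nthCollisionTime G ε γ a n ∈ collisionTimes G ε γ ∩ Ioc a s) ∧
      StrictMonoOn (nthCollisionTime G ε γ a) (Iic m) ∧
      ∀ u ∈ collisionTimes G ε γ ∩ Ioc a s, ∃ n ≤ m, nthCollisionTime G ε γ a n = u :=
  nthTimeAfter_enum h.finite_inter_Ioc hs has

/-- **Every collision of a particle is enumerated**: on a hard-sphere trajectory each collision
time of particle `k` after `a` is its `n`-th collision time after `a` for some `n`. [folklore] -/
theorem exists_nthCollisionTimeOf_eq (h : IsHardSphereTrajectory G ε N γ) {a s : ℝ} {k : Fin N}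
    (hs : s ∈ collisionTimesOf G ε γ k) (has : a < s) :
    ∃ n, nthCollisionTimeOf G ε γ a k n = s :=
  exists_nthTimeAfter_eq (h.finite_collisionTimesOf_inter_Ioc k) hs has

/-- On a hard-sphere trajectory, if particle `k` collides after its `n`-th collision time after
`a`, its `(n+1)`-st collision time after `a` is the least such later collision time of `k`.
[folklore] -/
theorem isLeast_nthCollisionTimeOf_succ (h : IsHardSphereTrajectory G ε N γ) {a : ℝ} {k : Fin N}
    {n : ℕ} (hne : (collisionTimesOf G ε γ k ∩ Ioi (nthCollisionTimeOf G ε γ a k n)).Nonempty) :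
    IsLeast (collisionTimesOf G ε γ k ∩ Ioi (nthCollisionTimeOf G ε γ a k n))
      (nthCollisionTimeOf G ε γ a k (n + 1)) :=
  isLeast_nthTimeAfter_succ (h.finite_collisionTimesOf_inter_Ioc k) hne

/-- Consecutive collision times of a particle increase strictly (as long as the particle collides
again). [folklore] -/
theorem nthCollisionTimeOf_lt_succ (h : IsHardSphereTrajectory G ε N γ) {a : ℝ} {k : Fin N}
    {n : ℕ} (hne : (collisionTimesOf G ε γ k ∩ Ioi (nthCollisionTimeOf G ε γ a k n)).Nonempty) :
    nthCollisionTimeOf G ε γ a k n < nthCollisionTimeOf G ε γ a k (n + 1) :=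
  (h.isLeast_nthCollisionTimeOf_succ hne).1.2

/-- **Free flight between consecutive collisions of a particle**: on a hard-sphere trajectory
particle `k` does not participate in any collision strictly between its `n`-th and `(n+1)`-st
collision times after `a`. [folklore] -/
theorem not_participates_of_mem_Ioo_nthCollisionTimeOf_succ (h : IsHardSphereTrajectory G ε N γ)
    {a : ℝ} {k : Fin N} {n : ℕ} {u : ℝ}
    (hu : u ∈ Ioo (nthCollisionTimeOf G ε γ a k n) (nthCollisionTimeOf G ε γ a k (n + 1))) :
    ¬ Participates G ε (γ u) k :=
  not_mem_of_mem_Ioo_nthTimeAfter_succ (h.finite_collisionTimesOf_inter_Ioc k) hu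

/-- Particle `k` does not participate in any collision strictly between `a` and its first
collision time after `a`. [folklore] -/
theorem not_participates_of_mem_Ioo_nthCollisionTimeOf_zero (h : IsHardSphereTrajectory G ε N γ)
    {a : ℝ} {k : Fin N} {u : ℝ} (hu : u ∈ Ioo a (nthCollisionTimeOf G ε γ a k 0)) :
    ¬ Participates G ε (γ u) k :=
  not_mem_of_mem_Ioo_nthTimeAfter_zero (h.finite_collisionTimesOf_inter_Ioc k a) hu

/-- **The collision times of particle `k` in the window `(a, s]` in increasing order**: on a
hard-sphere trajectory, for a collision time `s > a` of `k` there is `m` with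
`nthCollisionTimeOf G ε γ a k m = s`, `n ↦ nthCollisionTimeOf G ε γ a k n` strictly increasing on
`{0, …, m}` with values in, and onto, the collision times of `k` in `(a, s]`. [folklore] -/
theorem nthCollisionTimeOf_enum (h : IsHardSphereTrajectory G ε N γ) {a s : ℝ} {k : Fin N}
    (hs : s ∈ collisionTimesOf G ε γ k) (has : a < s) :
    ∃ m, nthCollisionTimeOf G ε γ a k m = s ∧
      (∀ n ≤ m, nthCollisionTimeOf G ε γ a k n ∈ collisionTimesOf G ε γ k ∩ Ioc a s) ∧
      StrictMonoOn (nthCollisionTimeOf G ε γ a k) (Iic m) ∧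
      ∀ u ∈ collisionTimesOf G ε γ k ∩ Ioc a s, ∃ n ≤ m, nthCollisionTimeOf G ε γ a k n = u :=
  nthTimeAfter_enum (h.finite_collisionTimesOf_inter_Ioc k) hs has

end IsHardSphereTrajectory

/-! ## Along the hard-sphere flow -/

namespace HardSphereFlow

variable [MeasureTheory.MeasureSpace X] [TopologicalSpace X] {G : Geometry d X} {ε : ℝ}
  (Φ : HardSphereFlow G ε N)

/-- Unfolding lemma: the `n`-th collision time of `i` along the flow is the `n`-th collision time
of `i` after time `0` of the orbit. [folklore] -/
theorem nthCollisionTimeOf_eq (i : Fin N) (n : ℕ) (z : Config N d X) :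
    Φ.nthCollisionTimeOf i n z = FluidPDE.nthCollisionTimeOf G ε (fun t => Φ.flow t z) 0 i n :=
  rfl

/-- **Every collision of a particle along the flow is enumerated**: on the good set, each
collision time `s > 0` of particle `i` along the orbit of `z` is `Φ.nthCollisionTimeOf i n z` for
some `n`. [folklore] -/
theorem exists_nthCollisionTimeOf_eq {z : Config N d X} (hz : z ∈ Φ.good) {i : Fin N} {s : ℝ}
    (hs : s ∈ collisionTimesOf G ε (fun t => Φ.flow t z) i) (h0 : 0 < s) :
    ∃ n, Φ.nthCollisionTimeOf i n z = s :=
  (Φ.isTrajectory z hz).exists_nthCollisionTimeOf_eq hs h0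

/-- On the good set, consecutive collision times of a particle along the flow increase strictly
(as long as the particle collides again). [folklore] -/
theorem nthCollisionTimeOf_lt_succ {z : Config N d X} (hz : z ∈ Φ.good) {i : Fin N} {n : ℕ}
    (hne : (collisionTimesOf G ε (fun t => Φ.flow t z) i ∩
      Ioi (Φ.nthCollisionTimeOf i n z)).Nonempty) :
    Φ.nthCollisionTimeOf i n z < Φ.nthCollisionTimeOf i (n + 1) z :=
  (Φ.isTrajectory z hz).nthCollisionTimeOf_lt_succ hne

/-- On the good set, particle `i` is in free flight (participates in no collision) strictly
between its `n`-th and `(n+1)`-st collision times along the flow. [folklore] -/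
theorem not_participates_of_mem_Ioo_nthCollisionTimeOf_succ {z : Config N d X} (hz : z ∈ Φ.good)
    {i : Fin N} {n : ℕ} {u : ℝ}
    (hu : u ∈ Ioo (Φ.nthCollisionTimeOf i n z) (Φ.nthCollisionTimeOf i (n + 1) z)) :
    ¬ Participates G ε (Φ.flow u z) i :=
  (Φ.isTrajectory z hz).not_participates_of_mem_Ioo_nthCollisionTimeOf_succ hu

/-- **The collisions of particle `i` up to time `s` along the flow, in increasing order**: on the
good set, for a collision time `s > 0` of `i` along the orbit of `z` there is `m` with
`Φ.nthCollisionTimeOf i m z = s`, `n ↦ Φ.nthCollisionTimeOf i n z` strictly increasing on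
`{0, …, m}` with values in, and onto, the collision times of `i` in `(0, s]`. [folklore] -/
theorem nthCollisionTimeOf_enum {z : Config N d X} (hz : z ∈ Φ.good) {i : Fin N} {s : ℝ}
    (hs : s ∈ collisionTimesOf G ε (fun t => Φ.flow t z) i) (h0 : 0 < s) :
    ∃ m, Φ.nthCollisionTimeOf i m z = s ∧
      (∀ n ≤ m, Φ.nthCollisionTimeOf i n z ∈ collisionTimesOf G ε (fun t => Φ.flow t z) i ∩ Ioc 0 s) ∧
      StrictMonoOn (fun n => Φ.nthCollisionTimeOf i n z) (Iic m) ∧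
      ∀ u ∈ collisionTimesOf G ε (fun t => Φ.flow t z) i ∩ Ioc 0 s,
        ∃ n ≤ m, Φ.nthCollisionTimeOf i n z = u :=
  (Φ.isTrajectory z hz).nthCollisionTimeOf_enum hs h0

end HardSphereFlow

end Kinetic

end

end Literature.Analysis.FluidPDE
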